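import Summits.AtomisticToContinuum.HydrodynamicLimit.Theses.ExpTailStaging
import Literature.MathematicalPhysics.KineticTheory.MicroscaleWindowFunctionals
import HarnessLib

/-!
# Birth skeleton (BC3) for crux `StagedEntropyGronwall` — item stmt-AtomisticToContinuum-11519,
# route `ExpTailStaging` (rank 4, THE STAGING LEMMA), sub-problem `HydrodynamicLimit`

Crux BY NAME: `Summit.AtomisticToContinuum.HydrodynamicLimit.Theses.ExpTailStaging.StagedEntropyGronwall`
`= MesoFluxClosure → ExpVelocityMomentBound → ⟨LocalGibbsConcentration text⟩ → ⟨HsEosLowDensity text⟩ →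
RelEntropyVanishing`: Yau's relative-entropy method for the DETERMINISTIC hard-sphere flow on `𝕋³` at
fixed small reduced density `σ`, run with ONE exponential velocity-moment rate (K1) instead of a
Gaussian cut-off, by a truncated Gronwall on STAGES of length `τ < κ/slope`, each stage restarting
from `limsup_N H/N = 0` (NachtergaeleYau2003 §5 Lemma 5.1, §7 / §7.2, arXiv:math-ph/0209027 p. 19;
OllaVaradhanYau1993 §3; the staging and the single rate are the route's own).

## The one intermediate quantity

`limsupEntropy σ a₀ θ₀ u₀ ρ θ u Φ s = limsup_N (N+1)⁻¹ H( law of Φ_N(s) under λ^N_{σ,a₀,u₀,θ₀} ‖ λ^N_{σ, a_s, u_s, θ_s} )`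
(`ℝ≥0∞`-valued, `InformationTheory.klDiv`, `HardSphereFlow.lawAt`), where the REFERENCE local Gibbs law
at time `s` is built on the Euler solution `(ρ, u, θ)` with the EXPLICIT activity profile
`a_s(x) = hsActivity (ρ_s(x) σ³)` — the tree's hard-sphere activity `z(η) = η·exp(f_ex(η) + η f_ex'(η))`
(`MicroscaleWindowFunctionals.lean`; `βμ = log z`), i.e. the inverse equation of state of the crux's plan
step (i) ("activity `a(ρ_s, σ)` by the inverse equation of state, HsEosLowDensity"). With this choice the
`∃ a` witness of `RelEntropyVanishing` at time `t` is `a_t` itself, and `RelEntropyVanishing`'s third clause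
at time `t` is LITERALLY `Tendsto (entropyPP … t) atTop (𝓝 0)`, which follows from `limsupEntropy … t = 0`.

## The cut (four named stubs; the crux's proof plan (i)–(vi) + the refuter's findings G1–G3 made seams)

* `stub_referenceStatics` — **UNIFORM IN-BAND STATICS OF THE REFERENCE (plan (vi) + inverse EOS; G1)**,
  size M/L: `HsEosLowDensity → ∃ η₁ > 0, ReferenceStatics η₁`: ONE packing threshold `η₁` such that for
  EVERY `σ > 0` and every continuous profile `(ρ, u, θ)` with `ρ, θ > 0`, `ρσ³ < η₁` pointwise and `∫ρ = 1`,
  the canonical local Gibbs laws with activity `x ↦ hsActivity(ρ(x)σ³)` are probability measures (all `N`,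
  all flows) whose empirical density / momentum / energy fields concentrate exponentially
  (`≤ C e^{-(N+1)/C}`) around `(ρ, ρu, E(ρ,u,θ))` — verbatim the concentration clause of
  `RelEntropyVanishing`. This replaces the crux's third hypothesis, whose `σ₀` depends on the profile
  `(a, θ₀, u₀)` and is therefore unusable for the time-`t` references (refuter finding G1); the tree holds
  the forward `η₀`-uniform exponential LLN `uniformLocalGibbsConcentration_proof` (item 14445: activity ↦
  SOME density `ρ₀`, guard `σ³ sup a ≤ η₀ ∫a`); what is added is the IDENTIFICATION of the LLN profile of
  the activity `z(ρσ³)` as `ρ` itself (local equation of state / equivalence of ensembles in the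
  cluster-expansion band: the Euler–Lagrange equation `z(η(x)) = c·a(x)` of the canonical free-energy
  functional has the solution `η = ρσ³`, `c = 1`, consistent with `∫ρ = 1`, unique by strict convexity of
  `η log η + η f_ex(η)` at small `η`). Tools: Ruelle1969 §4 / LebowitzPenrose1964, the machinery behind 14445.
* `stub_bandConfinement` — **THE TIED EULER SOLUTION STAYS IN THE BAND AT SMALL σ (non-implosion; where
  `∀ T` bites)**, size M–L, the RISK stub: `∀ η > 0, BandConfinement η`: for continuous profiles
  `(a₀, θ₀ > 0, u₀)` there is `σ₀ > 0` such that for `0 < σ < σ₀`, every classical hard-sphere Euler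
  solution `(ρ, u, θ)` on `[0, T)` and every flow family, IF the local Gibbs laws `λ^N_{σ,a₀,u₀,θ₀}` are
  probability measures and their fields converge at `t = 0` to `(ρ, ρu, E)(0)` (the tie: it forces
  `ρ(0) =` the dilute LLN profile of `a₀` at diameter `σ`, `u(0) = u₀`, `θ(0) = θ₀`), THEN for all
  `t ∈ [0, T)`: `ρ_t σ³ < η` pointwise and `∫ρ_t = 1`. The mass half is routine (continuity equation on
  `𝕋³` + `∫ρ_0 = 1` from the tie with `χ ≡ 1`, `empiricalDensityField_one`). The band half is
  Nachtergaele–Yau's NON-IMPLOSION assumption II.2 (arXiv:math-ph/0209027 §2.3), dropped by the crux as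
  typed (refuter finding G3) and here NAMED: compression of the tied dilute data by a factor `η/σ³ → ∞`
  before the first singularity (a smooth implosion à la Merle–Raphaël–Rodnianski–Szeftel for the
  `σ`-perturbed monatomic gas law `p = ρθ Z(ρσ³)`, from the specific tied data, for a sequence `σ ↓ 0`)
  would refute it — and with it, in all likelihood, the unguarded crux and target 0766 themselves; the
  route header's own repair is then the packing-guarded restatement (hypothesis
  `∀ t ∈ Ico 0 T, ∀ x, ρ t x * σ ^ 3 < η₀`), under which this stub becomes a hypothesis and drops out.
* `stub_initialEntropy` — **RESTART AT TIME 0: `limsup_N H(0)/N = 0` (plan (v), "H(0) = 0 because the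
  t = 0 LLN pins the Euler data to the local Gibbs profiles")**, size M: `ReferenceStatics η₁ →
  InitialEntropyVanishes η₁`: under the tie, `λ^N_{σ,a₀,u₀,θ₀}` and the time-0 reference
  `λ^N_{σ, z(ρ_0σ³), u_0, θ_0}` have relative entropy `o(N)` — in fact they COINCIDE once `u(0) = u₀`,
  `θ(0) = θ₀` (uniqueness of limits in probability) and `z(ρ_{a₀}σ³) = c·a₀` (the LLN profile of a
  dilute activity solves the local equation of state; the canonical law is invariant under `a ↦ c·a`);
  alternatively `(N+1)⁻¹H → ⟨ρ, log(a₀/a)⟩ − (p(a₀) − p(a)) = 0` by differentiability of the dilute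
  pressure functional. Not bookkeeping: it is the equivalence-of-ensembles input at `t = 0`, and it is
  where the flow's `lawAt … 0 = map (flow 0)` is identified with the initial law (`flow 0 = id` on the good
  set, `particleLaw ≪ liouville`).
* `stub_stagePropagation` — **ONE STAGE OF THE TRUNCATED RELATIVE-ENTROPY GRONWALL (plan (i)–(v)), size XL,
  LOAD-BEARING**: `ReferenceStatics η₁ → HsEosLowDensity → MesoFluxClosure → ExpVelocityMomentBound →
  StagePropagation η₁`: for profiles, `σ < σ₀`, a tied Euler solution staying in the band `η₁` on `[0, t]`
  (`t < T`) and any flow family, there is a STAGE LENGTH `τ > 0` such that on every window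
  `[s₁, s₂] ⊆ [0, t]` of length `≤ τ`, `limsupEntropy s₁ = 0 ⟹ limsupEntropy s₂ = 0`. Inside (the crux's
  plan, verbatim): (i) the time-integrated entropy identity for the Liouville flow against the smooth
  reference `ψ_s` (activity `z(ρ_sσ³)`, smooth in `(s, x)` by `HsEosLowDensity` + smoothness of `ρ`), written
  through exact empirical-field increments with the contact (collisional-transfer) currents; (ii)
  `MesoFluxClosure` replaces mean increments by `∫∫ F(U_h)·∇λ`, `λ` frozen on a finite time grid, freezing
  error paid by K1; (iii) Euler in entropy variables kills the linear part, leaving the quadratic flux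
  remainder `Ω(U_h, U*)`; (iv) truncation at block energy `M²`: tame part `≤ (c₀ θ_max ‖∇λ‖∞ M)·H/N + o_N(1)`
  (entropy inequality + a mesoscopic large-deviation bound for dilute local Gibbs laws at block scale
  `(N+1)^{-α}` — the informal support MesoPressureFunctional 11538, to be proved INSIDE this stub or split
  off by the lead; refuter finding G2), hot part `≤ C M³ e^{-κM/2}` by K1; (v) Gronwall on `[s₁, s₂]` with
  `s₂ − s₁ ≤ τ < κ/(2c₀θ_max sup‖∇λ‖)`: `limsup_N H(s₂)/N ≤ e^{cM(s₂−s₁)}[0 + CM³e^{-κM/2}(s₂ − s₁)]` for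
  every `M`, then `M → ∞`. Why it might fail (the crux's own line + refuter G3): a slope SUPERLINEAR in
  `M` for the hard-sphere currents with collisional transfer re-demands Gaussian tails; the hard-sphere
  pressure is entropic (configurational), so the energy cut-off alone does not tame the collisional part
  of `Ω` — the dilute-band LD bound must do it; NY2003 Lemma 5.1 is printed for superstable smooth pair
  potentials, not hard cores.

Composition `StagedEntropyGronwall_of` (a real proof, no `sorry`): thresholds `η₁` from stub 1 (fed the
crux's 4th hypothesis), `σ₀ := min` of the four `σ₀`'s (the crux's 3rd hypothesis at `(a₀, θ₀, u₀)` gives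
the probability-measure clause of `RelEntropyVanishing` and the `IsProbabilityMeasure` premise of stubs
2–4; stubs 2, 3, 4 give theirs); for `σ < σ₀`, a solution, flows, the tie and `t < T`: the witness
`a := z(ρ_tσ³)`, its probability/concentration clauses from stub 1 at the in-band normalised profile
`(ρ_t, u_t, θ_t)` (band and mass from stub 2, continuity/positivity from `IsHardSphereEulerSolution`), and
`limsupEntropy t = 0` by INDUCTION OVER STAGES: `limsupEntropy 0 = 0` (stub 3), and
`∀ k, ∀ s ∈ [0, t], s ≤ kτ → limsupEntropy s = 0` (step `s ↦ max (s − τ) 0`, stub 4), `k := ⌈t/τ⌉`;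
finally `limsup = 0 ⟹ Tendsto … (𝓝 0)` in `ℝ≥0∞`. So the four crux hypotheses are all consumed
(MFC, K1 → stub 4; LGC-text → probability of the initial laws; EOS-text → stubs 1, 4).

## Disproof used
No `Cruxes/StagedEntropyGronwall/Disproof.lean` exists (`ledger crux ls`: no workfiles); no landed
`Theorems/StagedEntropyGronwall/Negative/*`; `ledger negatives --problem AtomisticToContinuum` has no
statement of this file. The refuter's crux-attack (evidence CruxAttack.md, 2026-08-15) findings are
honoured AS SEAMS: G1 (profile-dependent `σ₀` of hypothesis 3; missing inverse activity map) ↦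
`stub_referenceStatics` with the explicit `hsActivity`; G2 (mesoscopic LD bound) ↦ inside
`stub_stagePropagation`, named in its docstring; G3 / NY II.2 (non-implosion dropped) ↦ `stub_bandConfinement`.

## BC3
`lean check` rc 0; sorries = 4 = stubs, zero elsewhere; probes `Sig.stub_X → StagedEntropyGronwall` and
`Sig.stub_X → _root_.HydrodynamicLimit` by `first | exact? | simpa [Sig.stub_X] | (unfold …; simpa) | aesop`
fail 8/8 (files `bc/StagedEntropyGronwall_probe*.lean` in the planner folder; see `Lines/birth.md`).
-/

noncomputable section

namespace Summit.AtomisticToContinuum.HydrodynamicLimit.Cruxes.StagedEntropyGronwall.Birth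

open scoped ENNReal Topology
open MeasureTheory Filter Set
open Literature.Analysis.FunctionSpaces Literature.Analysis.FluidPDE
open Literature.MathematicalPhysics.KineticTheory
open Summit.AtomisticToContinuum.HydrodynamicLimit.Theses.ExpTailStaging

/-! ## §0 Objects -/

/-- A family of hard-sphere flows of `N + 1` spheres of diameter `hsDiameter σ N` on `𝕋³`, one per `N`
(the `Φ` of the Statement). [folklore] -/
abbrev Flows (σ : ℝ) : Type :=
  (N : ℕ) → HardSphereFlow (Torus.geometry (Fin 3)) (hsDiameter σ N) (N + 1)

/-- The REFERENCE ACTIVITY PROFILE built on a macroscopic density profile `ρ` by the inverse equation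
of state: `a(x) = z(ρ(x)σ³)` with `z = hsActivity` the hard-sphere activity at reduced density
(`βμ = log z = log η + f_ex(η) + η f_ex'(η)`). In the cluster-expansion band the canonical local Gibbs
law with this activity has LLN density profile exactly `ρ` (when `∫ρ = 1`). [cite: Ruelle1969, §3.4] -/
def refActivity (σ : ℝ) (ρ : T3 → ℝ) : T3 → ℝ :=
  fun x => hsActivity (ρ x * σ ^ 3)

/-- RELATIVE ENTROPY PER PARTICLE at macroscopic time `s`:
`(N+1)⁻¹ H( (Φ_N(s))_* λ^N_{σ,a₀,u₀,θ₀} ‖ λ^N_{σ, z(ρ_sσ³), u_s, θ_s} )` — the law at time `s` of the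
deterministically evolved local Gibbs datum against the local Gibbs reference built on the Euler
solution `(ρ, u, θ)` at time `s` (Yau's `H(f_t | ψ_t)/N`). `ℝ≥0∞`-valued (`klDiv = ∞` off absolute
continuity). Written so that `fun N => entropyPP … t N` is SYNTACTICALLY the sequence in the third clause
of `RelEntropyVanishing` with witness `a := refActivity σ (ρ t)` unfolded. [cite: OllaVaradhanYau1993, §3] -/
def entropyPP (σ : ℝ) (a₀ θ₀ : T3 → ℝ) (u₀ : T3 → V3) (ρ θ : ℝ → T3 → ℝ) (u : ℝ → T3 → V3)
    (Φ : Flows σ) (s : ℝ) (N : ℕ) : ℝ≥0∞ :=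
  InformationTheory.klDiv ((Φ N).lawAt (localGibbsLaw σ a₀ u₀ θ₀ N (Φ N)) s)
      (localGibbsLaw σ (fun x => hsActivity (ρ s x * σ ^ 3)) (u s) (θ s) N (Φ N)) / ((N : ENNReal) + 1)

/-- `limsup_N` of the relative entropy per particle at time `s` — THE intermediate quantity of the
staged Gronwall (each stage restarts from `limsupEntropy = 0`). [cite: NachtergaeleYau2003, §7] -/
def limsupEntropy (σ : ℝ) (a₀ θ₀ : T3 → ℝ) (u₀ : T3 → V3) (ρ θ : ℝ → T3 → ℝ) (u : ℝ → T3 → V3)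
    (Φ : Flows σ) (s : ℝ) : ℝ≥0∞ :=
  limsup (fun N : ℕ => entropyPP σ a₀ θ₀ u₀ ρ θ u Φ s N) atTop

/-! ## §1 The four interfaces -/

/-- **Uniform in-band statics of the reference** (threshold `η₁` on the packing parameter `ρσ³`): for
EVERY `σ > 0` and every continuous profile `(ρ, u, θ)` with `ρ, θ > 0`, `ρσ³ < η₁` pointwise and `∫ρ = 1`,
the canonical local Gibbs laws with the inverse-EOS activity `x ↦ z(ρ(x)σ³)` are probability measures
(all `N`, all flows) and their empirical density / momentum / energy fields tested against any continuous
`χ` concentrate exponentially around `∫χρ`, `∫(χρ)u`, `∫χE(ρ,u,θ)` — verbatim the concentration clause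
of `RelEntropyVanishing` / `LocalGibbsConcentration`, but with the profile-INDEPENDENT threshold and the
EXPLICIT activity (so that it serves the time-`t` references). [cite: Ruelle1969, §4] -/
def ReferenceStatics (η₁ : ℝ) : Prop :=
  ∀ σ : ℝ, 0 < σ → ∀ (ρ θ : T3 → ℝ) (u : T3 → V3), Continuous ρ → Continuous θ → Continuous u →
    (∀ x, 0 < ρ x) → (∀ x, 0 < θ x) → (∀ x, ρ x * σ ^ 3 < η₁) → ∫ x, ρ x = 1 →
    (∀ (N : ℕ) (Φ : HardSphereFlow (Torus.geometry (Fin 3)) (hsDiameter σ N) (N + 1)),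
        IsProbabilityMeasure (localGibbsLaw σ (fun x => hsActivity (ρ x * σ ^ 3)) u θ N Φ)) ∧
    ∀ χ : T3 → ℝ, Continuous χ → ∀ δ : ℝ, 0 < δ → ∃ C : ℝ, 0 < C ∧
      ∀ (N : ℕ) (Φ : HardSphereFlow (Torus.geometry (Fin 3)) (hsDiameter σ N) (N + 1)),
        localGibbsLaw σ (fun x => hsActivity (ρ x * σ ^ 3)) u θ N Φ
            {z | δ < |empiricalDensityField z χ - ∫ x, χ x * ρ x|} ≤
          ENNReal.ofReal (C * Real.exp (-(C⁻¹ * (N + 1)))) ∧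
        localGibbsLaw σ (fun x => hsActivity (ρ x * σ ^ 3)) u θ N Φ
            {z | δ < ‖empiricalMomentumField z χ - ∫ x, (χ x * ρ x) • u x‖} ≤
          ENNReal.ofReal (C * Real.exp (-(C⁻¹ * (N + 1)))) ∧
        localGibbsLaw σ (fun x => hsActivity (ρ x * σ ^ 3)) u θ N Φ
            {z | δ < |empiricalEnergyField z χ - ∫ x, χ x * totalEnergyDensity (ρ x) (u x) (θ x)|} ≤
          ENNReal.ofReal (C * Real.exp (-(C⁻¹ * (N + 1))))

/-- **Band confinement of the tied Euler solution at small `σ`** (threshold `η`): for continuous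
profiles there is `σ₀ > 0` such that for `0 < σ < σ₀`, every classical hard-sphere Euler solution on
`[0, T)`, every flow family, if the local Gibbs laws `λ^N_{σ,a₀,u₀,θ₀}` are probability measures whose
fields converge at time `0` to `(ρ, ρu, E)(0)`, then at every `t ∈ [0, T)` the packing parameter stays
below `η` (`ρ_t σ³ < η` pointwise — Nachtergaele–Yau's non-implosion assumption II.2, to be PROVED for
the tied data at small `σ`) and the mass is normalised (`∫ρ_t = 1`, continuity equation + the tie).
[cite: NachtergaeleYau2003, §2.3] -/
def BandConfinement (η : ℝ) : Prop :=
  ∀ (a₀ θ₀ : T3 → ℝ) (u₀ : T3 → V3), Continuous a₀ → Continuous θ₀ → Continuous u₀ →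
    (∀ x, 0 < a₀ x) → (∀ x, 0 < θ₀ x) →
    ∃ σ₀ : ℝ, 0 < σ₀ ∧ ∀ σ : ℝ, 0 < σ → σ < σ₀ →
      ∀ (T : ℝ) (ρ θ : ℝ → T3 → ℝ) (u : ℝ → T3 → V3), IsHardSphereEulerSolution σ T ρ u θ →
        ∀ Φ : Flows σ, (∀ N, IsProbabilityMeasure (localGibbsLaw σ a₀ u₀ θ₀ N (Φ N))) →
          TendstoHydroFieldsAt (fun N => localGibbsLaw σ a₀ u₀ θ₀ N (Φ N)) Φ ρ u θ 0 →
            ∀ t ∈ Ico 0 T, (∀ x, ρ t x * σ ^ 3 < η) ∧ ∫ x, ρ t x = 1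

/-- **The restart at time `0`** (threshold `η₁`): for continuous profiles there is `σ₀ > 0` such that
for `0 < σ < σ₀`, fields `(ρ, u, θ)` whose time-`0` slices are continuous, positive, in the band `η₁` and
normalised, and flows: if the local Gibbs laws `λ^N_{σ,a₀,u₀,θ₀}` are probability measures tied at time
`0` to `(ρ, ρu, E)(0)`, then `limsup_N (N+1)⁻¹ H(λ^N ∘ Φ_N(0)⁻¹ ‖ λ^N_{σ, z(ρ_0σ³), u_0, θ_0}) = 0` (the two
dilute local Gibbs laws have the same limiting profiles, hence — local equation of state for the LLN
profile of `a₀`, scale invariance of the canonical law — coincide, or at least have `o(N)` relative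
entropy). [cite: KipnisLandim1999, A1.8] -/
def InitialEntropyVanishes (η₁ : ℝ) : Prop :=
  ∀ (a₀ θ₀ : T3 → ℝ) (u₀ : T3 → V3), Continuous a₀ → Continuous θ₀ → Continuous u₀ →
    (∀ x, 0 < a₀ x) → (∀ x, 0 < θ₀ x) →
    ∃ σ₀ : ℝ, 0 < σ₀ ∧ ∀ σ : ℝ, 0 < σ → σ < σ₀ →
      ∀ (ρ θ : ℝ → T3 → ℝ) (u : ℝ → T3 → V3),
        Continuous (ρ 0) → Continuous (θ 0) → Continuous (u 0) →
        (∀ x, 0 < ρ 0 x) → (∀ x, 0 < θ 0 x) → (∀ x, ρ 0 x * σ ^ 3 < η₁) → ∫ x, ρ 0 x = 1 →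
        ∀ Φ : Flows σ, (∀ N, IsProbabilityMeasure (localGibbsLaw σ a₀ u₀ θ₀ N (Φ N))) →
          TendstoHydroFieldsAt (fun N => localGibbsLaw σ a₀ u₀ θ₀ N (Φ N)) Φ ρ u θ 0 →
            limsupEntropy σ a₀ θ₀ u₀ ρ θ u Φ 0 = 0

/-- **Propagation of `limsup H/N = 0` across one stage** (threshold `η₁`): for continuous profiles there
is `σ₀ > 0` such that for `0 < σ < σ₀`, every classical hard-sphere Euler solution on `[0, T)`, every flow
family with the local Gibbs laws probability measures tied at time `0`, and every `t < T` such that the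
solution stays in the band `η₁` with normalised mass on `[0, t]`, there is a STAGE LENGTH `τ > 0`
(`τ < κ/(2c₀θ_max sup_{s≤t}‖∇λ_s‖∞)`: K1's rate over the entropy-inequality slope per unit cut-off) such
that on every window `[s₁, s₂] ⊆ [0, t]` of length `≤ τ`: `limsupEntropy s₁ = 0 → limsupEntropy s₂ = 0`
(truncated relative-entropy Gronwall `limsup H(s₂)/N ≤ e^{cM(s₂−s₁)}[limsup H(s₁)/N + CM³e^{−κM/2}(s₂−s₁)]`
for every cut-off `M`, then `M → ∞`). [cite: NachtergaeleYau2003, Lemma 5.1 and §7.2] -/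
def StagePropagation (η₁ : ℝ) : Prop :=
  ∀ (a₀ θ₀ : T3 → ℝ) (u₀ : T3 → V3), Continuous a₀ → Continuous θ₀ → Continuous u₀ →
    (∀ x, 0 < a₀ x) → (∀ x, 0 < θ₀ x) →
    ∃ σ₀ : ℝ, 0 < σ₀ ∧ ∀ σ : ℝ, 0 < σ → σ < σ₀ →
      ∀ (T : ℝ) (ρ θ : ℝ → T3 → ℝ) (u : ℝ → T3 → V3), IsHardSphereEulerSolution σ T ρ u θ →
        ∀ Φ : Flows σ, (∀ N, IsProbabilityMeasure (localGibbsLaw σ a₀ u₀ θ₀ N (Φ N))) →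
          TendstoHydroFieldsAt (fun N => localGibbsLaw σ a₀ u₀ θ₀ N (Φ N)) Φ ρ u θ 0 →
            ∀ t ∈ Ico 0 T, (∀ s ∈ Icc 0 t, (∀ x, ρ s x * σ ^ 3 < η₁) ∧ ∫ x, ρ s x = 1) →
              ∃ τ : ℝ, 0 < τ ∧ ∀ s₁ s₂ : ℝ, 0 ≤ s₁ → s₁ ≤ s₂ → s₂ ≤ t → s₂ - s₁ ≤ τ →
                limsupEntropy σ a₀ θ₀ u₀ ρ θ u Φ s₁ = 0 → limsupEntropy σ a₀ θ₀ u₀ ρ θ u Φ s₂ = 0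

/-! ## §2 Stub statements by name (the hypotheses of `StagedEntropyGronwall_of`) -/

namespace Sig

/-- Statement of `stub_referenceStatics`. [folklore] -/
def stub_referenceStatics : Prop :=
  HsEosLowDensity → ∃ η₁ : ℝ, 0 < η₁ ∧ ReferenceStatics η₁

/-- Statement of `stub_bandConfinement`. [folklore] -/
def stub_bandConfinement : Prop :=
  ∀ η : ℝ, 0 < η → BandConfinement η

/-- Statement of `stub_initialEntropy`. [folklore] -/
def stub_initialEntropy : Prop :=
  ∀ η₁ : ℝ, 0 < η₁ → ReferenceStatics η₁ → HsEosLowDensity → InitialEntropyVanishes η₁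

/-- Statement of `stub_stagePropagation`. [folklore] -/
def stub_stagePropagation : Prop :=
  ∀ η₁ : ℝ, 0 < η₁ → ReferenceStatics η₁ → HsEosLowDensity → MesoFluxClosure → ExpVelocityMomentBound →
    StagePropagation η₁

end Sig

/-! ## §3 The stubs (registered obligations; `sorry` lives ONLY here) -/

/-- **Stub 1 — UNIFORM IN-BAND STATICS OF THE REFERENCE (size M/L).** Given the low-density equation
of state (the crux's fourth hypothesis, by name), there is a packing threshold `η₁ > 0` below which the
canonical local Gibbs laws with the inverse-EOS activity `z(ρσ³)` are probability measures with an
exponential law of large numbers AT THE PRESCRIBED PROFILE `(ρ, ρu, E(ρ,u,θ))`, uniformly over `σ > 0`,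
`N`, flows and in-band normalised continuous profiles. Why plausibly true: velocities are exactly
conditionally Maxwellian (they integrate out of `canonicalDensity`), so only the configurational
inhomogeneous hard-sphere gas at slowly varying activity matters; in the blow-up by the diameter its
local reduced density solves `z(η(x)) = c·a(x)` (Euler–Lagrange equation of the strictly convex dilute
free-energy functional), and `a = z(ρσ³)`, `∫ρ = 1` give `η = ρσ³`, `c = 1`; exponential concentration
by the convergent cluster expansion (Lebowitz–Penrose 1964, Ruelle 1969 §4), as in the tree's forward
theorem `uniformLocalGibbsConcentration_proof` (item 14445). Why it might fail: the identification needs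
the analyticity band of `hsActivity` (`deriv hsExcessFreeEnergy` is junk off `(0, η₀)`), whence `η₁ ≤ η₀`
of `HsEosLowDensity`; small-`N` corners are absorbed by `C`. [cite: Ruelle1969, §4] -/
theorem stub_referenceStatics : Sig.stub_referenceStatics := by
  sorry

/-- **Stub 2 — BAND CONFINEMENT / NON-IMPLOSION OF THE TIED SOLUTION (size M–L; the risk stub).** For
every threshold `η > 0` and continuous profiles, at small `σ` every classical hard-sphere Euler solution
tied at time `0` to the local Gibbs data keeps `ρ_tσ³ < η` and `∫ρ_t = 1` on `[0, T)`. Why plausibly true: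
the tie pins `(ρ, u, θ)(0)` to the dilute LLN profile of `(a₀, u₀, θ₀)` (packing `O(σ³)`), mass is
conserved, and for generic smooth data the first singularity of the compressible Euler flow is a shock
with bounded density, uniformly for the `σ`-perturbed gas laws `p = ρθZ(ρσ³)` near the ideal gas. Why it
might fail: `∀ T` admits any time of classical existence — a smooth IMPLOSION (Merle–Raphaël–Rodnianski–
Szeftel type) of the tied data for a sequence `σ ↓ 0` compresses by `η/σ³` before blow-up; this is NY2003
Assumption II.2, which the unguarded crux silently needs (refuter G3); its refutation sends the route to
the packing-guarded restatement, where this stub is a hypothesis. [cite: NachtergaeleYau2003, §2.3] -/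
theorem stub_bandConfinement : Sig.stub_bandConfinement := by
  sorry

/-- **Stub 3 — THE RESTART AT TIME 0 (size M).** Below the statics threshold, the tied initial local
Gibbs law and the time-`0` reference `λ^N_{σ, z(ρ_0σ³), u_0, θ_0}` have `limsup_N (N+1)⁻¹ H = 0`. Why
plausibly true: uniqueness of limits in probability gives `ρ(0) = ρ_{a₀}` (the LLN profile of `a₀`),
`u(0) = u₀`, `θ(0) = θ₀`; the LLN profile of a dilute activity solves the local equation of state, so
`z(ρ_{a₀}σ³) = c·a₀` and the two canonical laws COINCIDE (`canonicalDensity` is invariant under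
`a ↦ c·a`), `klDiv μ μ = 0`; `lawAt … 0 = map (flow 0) =` the initial law (`flow_zero` on the conull good
set, `particleLaw ≪ liouville`). Fallback: `(N+1)⁻¹H → ⟨ρ, log(a₀/a)⟩ − (p(a₀) − p(a)) = 0` by convexity and
differentiability of the dilute pressure functional. Why it might fail: only through the identification
of the LLN profile of an ARBITRARY continuous activity `a₀` (not just of `z(ρσ³)`) — the same
cluster-expansion input as stub 1, used in the converse direction. [cite: KipnisLandim1999, A1.8] -/
theorem stub_initialEntropy : Sig.stub_initialEntropy := by
  sorry

/-- **Stub 4 — ONE STAGE OF THE TRUNCATED RELATIVE-ENTROPY GRONWALL (size XL, load-bearing).** Given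
the in-band reference statics, the equation of state, the mesoscopic flux closure in mean (MFC, the
ergodic sector) and ONE exponential velocity-moment rate `κ` along the flow (K1), `limsup H/N = 0`
propagates across windows of length `≤ τ`, `τ < κ/(2c₀θ_max sup‖∇λ‖)`. Inside: (i) entropy identity for
the Liouville flow against the smooth reference `ψ_s` with contact currents; (ii) closure by MFC with `λ`
frozen on a time grid (freezing error by K1); (iii) Euler in entropy variables cancels the linear part;
(iv) truncation at block energy `M²`: tame part `≤ (c₀θ_max‖∇λ‖∞M)·H/N + o_N(1)` by the entropy inequality
and a block-scale large-deviation bound for dilute local Gibbs laws (MesoPressureFunctional, proved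
inside or split off), hot part `≤ CM³e^{−κM/2}` by K1 (a hot block needs fast particles); (v) Gronwall on
the window and `M → ∞` (`e^{cMτ}M³e^{−κM/2} → 0` because `cτ < κ/2`). Why it might fail: a slope
superlinear in `M` for the hard-sphere currents (collisional transfer) re-demands Gaussian tails
(NY2003 §7.2); the hard-sphere pressure is configurational, so the energy cut-off does not tame the
collisional part of `Ω` — the dilute LD bound must; NY Lemma 5.1 is printed for smooth superstable
potentials; mean closure at fixed `ζ` may not freeze along `λ(s,·)`. Foreseen split (lead's call):
EntropyIdentityWithClosure (i)–(iii) → TruncatedLdStep (iv) → this. [cite: NachtergaeleYau2003, Lemma 5.1 and §7.2] -/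
theorem stub_stagePropagation : Sig.stub_stagePropagation := by
  sorry

/-! ## §4 The composition (real proof) -/

/-- Induction over stages: if `limsupEntropy 0 = 0` and `limsupEntropy = 0` propagates across every
window of length `≤ τ` inside `[0, t]`, then `limsupEntropy s = 0` for all `s ∈ [0, t]`. [folklore] -/
theorem limsupEntropy_eq_zero_of_stages {σ : ℝ} {a₀ θ₀ : T3 → ℝ} {u₀ : T3 → V3}
    {ρ θ : ℝ → T3 → ℝ} {u : ℝ → T3 → V3} {Φ : Flows σ} {t τ : ℝ} (hτ : 0 < τ)
    (h0 : limsupEntropy σ a₀ θ₀ u₀ ρ θ u Φ 0 = 0)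
    (hstep : ∀ s₁ s₂ : ℝ, 0 ≤ s₁ → s₁ ≤ s₂ → s₂ ≤ t → s₂ - s₁ ≤ τ →
      limsupEntropy σ a₀ θ₀ u₀ ρ θ u Φ s₁ = 0 → limsupEntropy σ a₀ θ₀ u₀ ρ θ u Φ s₂ = 0) :
    ∀ s : ℝ, 0 ≤ s → s ≤ t → limsupEntropy σ a₀ θ₀ u₀ ρ θ u Φ s = 0 := by
  -- `P k`: the claim for all `s ≤ k τ`
  have key : ∀ k : ℕ, ∀ s : ℝ, 0 ≤ s → s ≤ t → s ≤ (k : ℝ) * τ →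
      limsupEntropy σ a₀ θ₀ u₀ ρ θ u Φ s = 0 := by
    intro k
    induction k with
    | zero =>
      intro s hs0 _ hsk
      have hs : s = 0 := le_antisymm (by simpa using hsk) hs0
      subst hs
      exact h0
    | succ k ih =>
      intro s hs0 hst hsk
      -- restart point `s₁ := max (s - τ) 0`
      set s₁ : ℝ := max (s - τ) 0 with hs₁
      have hs₁0 : 0 ≤ s₁ := le_max_right _ _
      have hs₁s : s₁ ≤ s := max_le (by linarith) hs0
      have hs₁k : s₁ ≤ (k : ℝ) * τ := by
        refine max_le ?_ (by positivity)
        have : ((k + 1 : ℕ) : ℝ) * τ = (k : ℝ) * τ + τ := by push_cast; ring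
        linarith
      have hwin : s - s₁ ≤ τ := by
        have : s - τ ≤ s₁ := le_max_left _ _
        linarith
      exact hstep s₁ s hs₁0 hs₁s hst hwin (ih s₁ hs₁0 (hs₁s.trans hst) hs₁k)
  intro s hs0 hst
  obtain ⟨k, hk⟩ := exists_nat_ge (s / τ)
  refine key k s hs0 hst ?_
  rwa [div_le_iff₀ hτ] at hk

/-- **The skeleton theorem.** Statics ∘ band confinement ∘ restart ∘ staged Gronwall: given the four
stubs (by name), the crux `StagedEntropyGronwall` — literally the route decl — follows; all four of the
crux's own hypotheses are consumed (MFC and K1 by the stage stub, the local-Gibbs-concentration text for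
the probability of the initial laws, the equation-of-state text by the statics, restart and stage
stubs). [folklore] -/
theorem StagedEntropyGronwall_of :
    Sig.stub_referenceStatics → Sig.stub_bandConfinement → Sig.stub_initialEntropy →
      Sig.stub_stagePropagation →
      Summit.AtomisticToContinuum.HydrodynamicLimit.Theses.ExpTailStaging.StagedEntropyGronwall := by
  intro hS hB hI hP hMFC hK1 hLGC hEOS a₀ θ₀ u₀ ha hθ hu ha0 hθ0
  -- thresholds
  obtain ⟨η₁, hη₁, hRS⟩ := hS hEOS
  obtain ⟨σ₁, hσ₁, H1⟩ := hLGC a₀ θ₀ u₀ ha hθ hu ha0 hθ0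
  obtain ⟨σ₂, hσ₂, H2⟩ := hB η₁ hη₁ a₀ θ₀ u₀ ha hθ hu ha0 hθ0
  obtain ⟨σ₃, hσ₃, H3⟩ := hI η₁ hη₁ hRS hEOS a₀ θ₀ u₀ ha hθ hu ha0 hθ0
  obtain ⟨σ₄, hσ₄, H4⟩ := hP η₁ hη₁ hRS hEOS hMFC hK1 a₀ θ₀ u₀ ha hθ hu ha0 hθ0
  refine ⟨min (min σ₁ σ₂) (min σ₃ σ₄), lt_min (lt_min hσ₁ hσ₂) (lt_min hσ₃ hσ₄), ?_⟩
  intro σ hσ hσlt T ρ θ u hsol Φ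
  have h12 : σ < min σ₁ σ₂ := lt_of_lt_of_le hσlt (min_le_left _ _)
  have h34 : σ < min σ₃ σ₄ := lt_of_lt_of_le hσlt (min_le_right _ _)
  have hlt₁ : σ < σ₁ := lt_of_lt_of_le h12 (min_le_left _ _)
  have hlt₂ : σ < σ₂ := lt_of_lt_of_le h12 (min_le_right _ _)
  have hlt₃ : σ < σ₃ := lt_of_lt_of_le h34 (min_le_left _ _)
  have hlt₄ : σ < σ₄ := lt_of_lt_of_le h34 (min_le_right _ _)
  -- the initial local Gibbs laws are probability measures (crux hypothesis 3 at the initial profile)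
  obtain ⟨_, -, -, hprob, -⟩ := H1 σ hσ hlt₁
  have hPr : ∀ N, IsProbabilityMeasure (localGibbsLaw σ a₀ u₀ θ₀ N (Φ N)) := fun N => hprob N (Φ N)
  refine ⟨hPr, fun htie t ht => ?_⟩
  -- band and mass along the tied solution (stub 2)
  have hband : ∀ s ∈ Ico 0 T, (∀ x, ρ s x * σ ^ 3 < η₁) ∧ ∫ x, ρ s x = 1 :=
    H2 σ hσ hlt₂ T ρ θ u hsol Φ hPr htie
  obtain ⟨hbt, hmt⟩ := hband t ht
  -- the time-`t` slices of the classical solution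
  have hρc : Continuous (ρ t) := (hsol.smooth_density.isSmooth_slice ht).continuous
  have hθc : Continuous (θ t) := (hsol.smooth_temperature.isSmooth_slice ht).continuous
  have huc : Continuous (u t) := (hsol.smooth_velocity.isSmooth_slice ht).continuous
  -- statics of the reference at the in-band normalised profile `(ρ_t, u_t, θ_t)` (stub 1)
  obtain ⟨hQ, hconc⟩ := hRS σ hσ (ρ t) (θ t) (u t) hρc hθc huc (hsol.density_pos t ht)
    (hsol.temperature_pos t ht) hbt hmt
  refine ⟨fun x => hsActivity (ρ t x * σ ^ 3), fun N => hQ N (Φ N), fun χ hχ δ hδ => ?_, ?_⟩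
  · obtain ⟨C, hC, hh⟩ := hconc χ hχ δ hδ
    exact ⟨C, hC, fun N => hh N (Φ N)⟩
  · -- staging: `limsupEntropy 0 = 0` (stub 3), propagation across stages of length `τ` (stub 4)
    have h0T : (0 : ℝ) ∈ Ico 0 T := ⟨le_rfl, ht.1.trans_lt ht.2⟩
    obtain ⟨hb0, hm0⟩ := hband 0 h0T
    have hzero : limsupEntropy σ a₀ θ₀ u₀ ρ θ u Φ 0 = 0 :=
      H3 σ hσ hlt₃ ρ θ u (hsol.smooth_density.isSmooth_slice h0T).continuous
        (hsol.smooth_temperature.isSmooth_slice h0T).continuous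
        (hsol.smooth_velocity.isSmooth_slice h0T).continuous (hsol.density_pos 0 h0T)
        (hsol.temperature_pos 0 h0T) hb0 hm0 Φ hPr htie
    obtain ⟨τ, hτ, hstep⟩ := H4 σ hσ hlt₄ T ρ θ u hsol Φ hPr htie t ht
      (fun s hs => hband s ⟨hs.1, hs.2.trans_lt ht.2⟩)
    have hHt : limsupEntropy σ a₀ θ₀ u₀ ρ θ u Φ t = 0 :=
      limsupEntropy_eq_zero_of_stages hτ hzero hstep t ht.1 le_rfl
    -- `limsup = 0` in `ℝ≥0∞` gives convergence to `0`
    refine tendsto_of_le_liminf_of_limsup_le bot_le (le_of_eq ?_)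
    exact hHt

end Summit.AtomisticToContinuum.HydrodynamicLimit.Cruxes.StagedEntropyGronwall.Birth

end
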